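import Mathlib
import HarnessLib
import Summits.NavierStokesRegularity.NavierStokesRegularity.Theorems.UnthreadedDoorCellFluxNetFluxLeClusterFlux
import Summits.NavierStokesRegularity.NavierStokesRegularity.Theorems.UnthreadedDoorNetFluxOneSidedLawPointwise
import Summits.NavierStokesRegularity.NavierStokesRegularity.Theorems.UnthreadedDoorIndicatrixAnalyticDataOfDecay
import Summits.NavierStokesRegularity.NavierStokesRegularity.Theorems.UnthreadedDoorIndicatrixWindowDecayTame
import Summits.NavierStokesRegularity.NavierStokesRegularity.Theorems.UnthreadedDoorIndicatrixCellCountNearCentre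
import Summits.NavierStokesRegularity.NavierStokesRegularity.Theorems.UnthreadedDoorIndicatrixClusterOscLeIndicatrix
import Summits.NavierStokesRegularity.NavierStokesRegularity.Theorems.UnthreadedDoorIndicatrixCriticalValuesFinite
import Summits.NavierStokesRegularity.NavierStokesRegularity.Theorems.UnthreadedDoorIndicatrixAnalyticCellFiniteness
import Summits.NavierStokesRegularity.NavierStokesRegularity.Theorems.UnthreadedDoorIndicatrixTypeIHessianBound
import Summits.NavierStokesRegularity.NavierStokesRegularity.Theorems.UnthreadedDoorNetFluxTypeIVorticityBound
import Summits.NavierStokesRegularity.NavierStokesRegularity.Theorems.UnthreadedDoorCellFluxClusterFluxNearCentreCap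
import Summits.NavierStokesRegularity.NavierStokesRegularity.Theorems.UnthreadedDoorCellFluxClusterFluxZero

/-!
# Route `UnthreadedDoor`, crux `PoloidalLiouville` (stmt-NavierStokesRegularity-1222), WALL W1 — crux idea «indicatrix-bound», the COMPOSITION:
# the corrected count-free chain down to K3^ω, kernel-composed modulo its open geometric inputs

★★ `analyticDataTypeIScalarLiouville_of : VandendriesMiller1994_realAnExp_isOMinimal → <Λ-1 HeadClusterRuleTame> → <Λ-2 ClusterFluxOneSidedLawTame> →
<Λ-0b+c IndicatrixLeHessian> → ClusterFluxNearCentreLipschitz → <K3^ω AnalyticDataTypeIScalarLiouville>` — the indicatrix chain of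
`Cruxes/PoloidalLiouville/IndicatrixSketch.lean` v1.7.3 COMPOSED IN THE KERNEL from the landed pieces: Λ-0a `clusterOscLeIndicatrix_of` (p727606) + Λ-geo″
`analyticCriticalValuesFinite_of_realAnExp` (p727430) give Λ-0′ with Λ-0b+c (`indicatrixGrowthL2_of'`, the sketch's kernel split re-proved Theorems-side);
Σ-0b′ = Σ-0bR₁ (`CellFlux.clusterFluxNearCentreCap_of CellFlux.clusterFluxLeVorticity`, p718757/p717414) + Σ-0bR₂ (hypothesis) by `clusterFluxNearCentreLinked_of`
(p726325); Λ-geo‴ `analyticCellCountNearCentre_of_realAnExp` (p729088); Λ-3 `clusterFluxWindowDecayTame'_of` (`…IndicatrixWindowDecayTame`); Λ-geo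
`analyticCellFiniteness_of_realAnExp` (ARM A g8, p727975); NF-2 `NetFlux.typeIVorticityBound` (p660105); Λ-T′ `Indicatrix.typeIHessianBound` (p725408); Σ-0c
`CellFlux.clusterFluxZero` (p694612); Λ-4 `analyticData_of_decay` (`…IndicatrixAnalyticDataOfDecay`).
WHAT REMAINS OPEN on this road to K3^ω: Λ-1 (the head-cluster rule), Λ-2 (its one-sided law), Λ-0b+c (the PS07 bridge), Σ-0bR₂ (near-centre Lipschitz control)
and the one standing o-minimality fact.  HONEST: nothing here is an NS statement; K3^ω, ⟨1222⟩, W1 and NS regularity are OPEN — NOT proved.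
`--supports stmt-NavierStokesRegularity-1222 --as helper`.  [folklore]
-/


noncomputable section

-- the summit and its single sub-problem share the name (CONVENTIONS §1)
set_option linter.dupNamespace false

open Set Function Filter Topology InnerProductSpace Metric MeasureTheory
open scoped RealInnerProductSpace

namespace Summit.NavierStokesRegularity.NavierStokesRegularity.Theorems.PoloidalLiouville.Indicatrix

open Literature.Analysis Literature.Analysis.FluidPDE
open Summit.NavierStokesRegularity.NavierStokesRegularity.Theorems.PoloidalLiouville.NetFlux
  (E3 sphSup sphInf sphOsc netFlux CurledLaw exists_headPotential cross_sub_smul_eq_zero_of_head)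
open Summit.NavierStokesRegularity.NavierStokesRegularity.Theorems.PoloidalLiouville.CellFlux
  (sphCrit isoCrit cellSet setOsc clusterFlux IsClusterPartition AdmissibleRule OneSidedLawFor cellFinitePred ClusterFluxZero
   ClusterFluxNearCentreLipschitz netFlux_le_clusterFlux)

/-- (kernel) **Λ-0′ = Λ-0a + Λ-0b+c**, Theorems-side (the sketch's `indicatrixGrowthL2_of`, verbatim logic): the cluster-oscillation/indicatrix comparison
and the indicatrix/Hessian bound give the count-free growth `clusterFlux ≤ C r² sup_{S_r}‖D²u‖`. [folklore] -/
theorem indicatrixGrowthL2_of'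
    (ha : ∀ (x₀ : E3) (f : E3 → ℝ) (r : ℝ) (𝒦 : Set (Set E3)), 0 < r → AnalyticOnNhd ℝ f ({x₀}ᶜ : Set E3) →
      IsClusterPartition f x₀ r 𝒦 → (∀ K ∈ 𝒦, IsPreconnected (f '' K)) →
      ENNReal.ofReal (∑ᶠ K ∈ 𝒦, setOsc f K) ≤ Literature.Analysis.PDE.banachIndicatrix (Metric.sphere x₀ r) f)
    (hb : ∃ C : ℝ, 0 ≤ C ∧ ∀ (u : E3 → E3) (x₀ : E3) (f : E3 → ℝ) (r K : ℝ), 0 < r →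
      ContDiff ℝ 2 u → AnalyticOnNhd ℝ f ({x₀}ᶜ : Set E3) →
      (∀ x, curl u x = cross (gradient f x) (x - x₀)) →
      (∀ x ∈ Metric.sphere x₀ r, ‖iteratedFDeriv ℝ 2 u x‖ ≤ K) →
      Literature.Analysis.PDE.banachIndicatrix (Metric.sphere x₀ r) f ≤ ENNReal.ofReal (C * r * K)) :
    ∃ C : ℝ, 0 ≤ C ∧ ∀ (u : E3 → E3) (x₀ : E3) (f : E3 → ℝ) (r K : ℝ) (𝒦 : Set (Set E3)), 0 < r →
      ContDiff ℝ 2 u → AnalyticOnNhd ℝ f ({x₀}ᶜ : Set E3) →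
      (∀ x, curl u x = cross (gradient f x) (x - x₀)) →
      (∀ x ∈ Metric.sphere x₀ r, ‖iteratedFDeriv ℝ 2 u x‖ ≤ K) →
      IsClusterPartition f x₀ r 𝒦 → (∀ K ∈ 𝒦, IsPreconnected (f '' K)) →
      clusterFlux f r 𝒦 ≤ C * r ^ 2 * K := by
  obtain ⟨C, hC0, hC⟩ := hb
  refine ⟨C, hC0, ?_⟩
  intro u x₀ f r K 𝒦 hr hu hf hlink hK h𝒦 hpre
  have hKnn : 0 ≤ K := by
    obtain ⟨x, hx⟩ := (NormedSpace.sphere_nonempty (x := x₀) (r := r)).mpr hr.le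
    exact (norm_nonneg _).trans (hK x hx)
  have h3 : ENNReal.ofReal (∑ᶠ K ∈ 𝒦, setOsc f K) ≤ ENNReal.ofReal (C * r * K) :=
    (ha x₀ f r 𝒦 hr hf h𝒦 hpre).trans (hC u x₀ f r K hr hu hf hlink hK)
  have h4 : ∑ᶠ K ∈ 𝒦, setOsc f K ≤ C * r * K :=
    (ENNReal.ofReal_le_ofReal_iff (mul_nonneg (mul_nonneg hC0 hr.le) hKnn)).mp h3
  unfold clusterFlux
  calc r * ∑ᶠ K ∈ 𝒦, setOsc f K ≤ r * (C * r * K) := mul_le_mul_of_nonneg_left h4 hr.le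
    _ = C * r ^ 2 * K := by ring

/-- ★★ **THE COMPOSITION: the count-free indicatrix chain down to K3^ω, modulo its open inputs.**  Assuming the o-minimality of `ℝ_an,exp`, the head-cluster
rule Λ-1, its one-sided law Λ-2, the indicatrix/Hessian bound Λ-0b+c (bodies verbatim) and the near-centre Lipschitz control Σ-0bR₂, Type-I scalar Liouville
holds for jointly real-analytic unthreaded data (`AnalyticDataTypeIScalarLiouville`, body verbatim) — every other link is a landed theorem cited by name. [folklore] -/
theorem analyticDataTypeIScalarLiouville_of
    (hO : Literature.ModelTheory.ExponentialFields.VandendriesMiller1994_realAnExp_isOMinimal)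
    (h1 : ∀ (v : ℝ → E3 → E3) (x₀ : E3) (T P : ℝ → E3 → ℝ) (V : ℝ → ℝ) (t₀ : ℝ),
      ContDiffOn ℝ (⊤ : ℕ∞) (uncurry v) (Ioo t₀ 0 ×ˢ univ) →
      ContDiffOn ℝ (⊤ : ℕ∞) (uncurry T) (Ioo t₀ 0 ×ˢ ({x₀}ᶜ : Set E3)) →
      (∀ t ∈ Ioo t₀ 0, ContDiffOn ℝ 1 (P t) ({x₀}ᶜ : Set E3)) →
      (∀ t ∈ Ioo t₀ 0, ∀ x, ‖v t x‖ ≤ V t) →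
      (∀ t ∈ Ioo t₀ 0, ∀ x, x ≠ x₀ →
          cross (gradient (P t) x - (inner ℝ (v t x) (x - x₀)) • gradient (T t) x) (x - x₀) = 0) →
      (∀ t ∈ Ioo t₀ 0, ∀ x, curl (v t) x = cross (gradient (T t) x) (x - x₀)) →
      CurledLaw v x₀ T (Ioo t₀ 0) →
      AnalyticOnNhd ℝ (uncurry v) (Ioo t₀ 0 ×ˢ (univ : Set E3)) →
      AnalyticOnNhd ℝ (uncurry T) (Ioo t₀ 0 ×ˢ ({x₀}ᶜ : Set E3)) →
      (∀ t ∈ Ioo t₀ 0, cellFinitePred v x₀ T t) →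
      ∃ 𝒞 : ℝ → ℝ → Set (Set E3), AdmissibleRule x₀ T P V t₀ 𝒞 ∧
        ∀ t ∈ Ioo t₀ 0, ∀ r > 0, ∀ K ∈ 𝒞 t r, IsPreconnected (T t '' K))
    (h2 : ∀ (v : ℝ → E3 → E3) (x₀ : E3) (T P : ℝ → E3 → ℝ) (V : ℝ → ℝ) (t₀ : ℝ),
      ContDiffOn ℝ (⊤ : ℕ∞) (uncurry v) (Ioo t₀ 0 ×ˢ univ) →
      ContDiffOn ℝ (⊤ : ℕ∞) (uncurry T) (Ioo t₀ 0 ×ˢ ({x₀}ᶜ : Set E3)) →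
      (∀ t ∈ Ioo t₀ 0, ContDiffOn ℝ 1 (P t) ({x₀}ᶜ : Set E3)) →
      (∀ t ∈ Ioo t₀ 0, ∀ x, ‖v t x‖ ≤ V t) →
      (∀ t ∈ Ioo t₀ 0, ∀ x, x ≠ x₀ →
          cross (gradient (P t) x - (inner ℝ (v t x) (x - x₀)) • gradient (T t) x) (x - x₀) = 0) →
      (∀ t ∈ Ioo t₀ 0, ∀ x, curl (v t) x = cross (gradient (T t) x) (x - x₀)) →
      CurledLaw v x₀ T (Ioo t₀ 0) →
      (∀ t ∈ Ioo t₀ 0, cellFinitePred v x₀ T t) →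
      ∀ 𝒞 : ℝ → ℝ → Set (Set E3), AdmissibleRule x₀ T P V t₀ 𝒞 →
        OneSidedLawFor (fun t r => clusterFlux (T t) r (𝒞 t r)) V t₀ (fun _ => True))
    (hb : ∃ C : ℝ, 0 ≤ C ∧ ∀ (u : E3 → E3) (x₀ : E3) (f : E3 → ℝ) (r K : ℝ), 0 < r →
      ContDiff ℝ 2 u → AnalyticOnNhd ℝ f ({x₀}ᶜ : Set E3) →
      (∀ x, curl u x = cross (gradient f x) (x - x₀)) →
      (∀ x ∈ Metric.sphere x₀ r, ‖iteratedFDeriv ℝ 2 u x‖ ≤ K) →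
      Literature.Analysis.PDE.banachIndicatrix (Metric.sphere x₀ r) f ≤ ENNReal.ofReal (C * r * K))
    (hR₂ : ClusterFluxNearCentreLipschitz) :
    ∀ (v : ℝ → E3 → E3) (x₀ : E3) (T : ℝ → E3 → ℝ),
      (∃ C : ℝ, HasTypeITimeDecay C v) →
      IsBoundedAncientMildSolution 1 v →
      (∀ t < 0, AEStronglyMeasurable (v t) volume) →
      ContDiffOn ℝ (⊤ : ℕ∞) (uncurry v) (Iio 0 ×ˢ univ) →
      ContDiffOn ℝ (⊤ : ℕ∞) (uncurry T) (Iio 0 ×ˢ ({x₀}ᶜ : Set E3)) →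
      (∃ C : ℝ, ∀ t < 0, ∀ x, |T t x| ≤ C) →
      (∀ t < 0, ∀ x, curl (v t) x = cross (gradient (T t) x) (x - x₀)) →
      CurledLaw v x₀ T (Iio 0) →
      AnalyticOnNhd ℝ (uncurry v) (Iio 0 ×ˢ (univ : Set E3)) →
      AnalyticOnNhd ℝ (uncurry T) (Iio 0 ×ˢ ({x₀}ᶜ : Set E3)) →
      ∀ t < 0, ∀ x, cross (gradient (T t) x) (x - x₀) = 0 :=
  analyticData_of_decay h1
    (clusterFluxWindowDecayTame'_of h2
      (indicatrixGrowthL2_of' (clusterOscLeIndicatrix_of (analyticCriticalValuesFinite_of_realAnExp hO)) hb)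
      (CellFlux.clusterFluxNearCentreLinked_of (CellFlux.clusterFluxNearCentreCap_of CellFlux.clusterFluxLeVorticity) hR₂)
      (analyticCellCountNearCentre_of_realAnExp hO))
    CellFlux.clusterFluxZero (analyticCellFiniteness_of_realAnExp hO) NetFlux.typeIVorticityBound typeIHessianBound

end Summit.NavierStokesRegularity.NavierStokesRegularity.Theorems.PoloidalLiouville.Indicatrix

end
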